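import Literature.NumberTheory.DiophantineGeometry.MordellEquationPowerSavingBounds
import HarnessLib

/-!
# Pasten 2026 (arXiv v1): Thm 1.1, Thm 1.4 and Thm 1.2 PROVED from the claim Thm 1.3
# (proofs-only companion of `MordellEquationPowerSavingBounds.lean`; theorems only, D-0026)

Topic `Literature/NumberTheory/DiophantineGeometry` (family `abc`, LADDER-ABC A1; cell abc-stewartyu,
seat lit-abc-pasten g4). Source: H. Pasten, *Power-saving bounds for Thue–Mahler and Mordell
equations*, arXiv:2608.23559v1 (24 Aug 2026) [`Pasten2026ThueMahlerMordell`], §1.1 — an UNREFEREED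
preprint with declared AI assistance, typed in the statements file as CLAIMS
(`[claim: …, status: under-review]`). This file introduces NO statement record and NO named fact: it
kernel-checks the three one-line deductions printed in §1.1, so that Theorems 1.1, 1.2 and 1.4 of
the source are theorems CONDITIONAL ON the single claim `Pasten2026.mordell_log_le_truncTwo`
(Thm 1.3) rather than three further claims:

* `Pasten2026.mordell_log_le_sqrt` — Thm 1.1 (`log max{|x|,|y|} ≪ |k|^{1/2} (log 2|k|)⁴`) from Thm 1.3,
  "Since `n̲ ≤ |n|`" (`Pasten2026.truncTwo_le_natAbs`); our constant `2 max(C, 0)` comes from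
  `log(k̲ log(3|k|)) ≤ log(3k²) ≤ 2 log(2|k|)`.
* `Pasten2026.mordell_log_le_radical` — Thm 1.4 (`≪ rad k (log 2 rad k)² log(2|k|) log(rad k log 3|k|)`)
  from Thm 1.3, "Since `(n̲)^{1/2} ≤ rad(n)`" (`Pasten2026.truncTwo_le_radical_sq`); our constant
  `8 max(C, 0)` comes from `log(2k̲) ≤ 2 log(2 rad k)` and `log(k̲ log 3|k|) ≤ 2 log(rad k log 3|k|)`.
* `Pasten2026.cube_sub_sq_ge_of_mordell_log_le_sqrt` — Thm 1.2 (`|x³ − y²| ≫ (log X)²/(log log X)⁸`,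
  `X = max{3,|x|,|y|}`) from the Thm 1.1 bound taken as a hypothesis formula ("An immediate
  consequence of Theorem 1.1"), by the inversion spelled out in its docstring; and
  `Pasten2026.cube_sub_sq_ge` — the same from the claim Thm 1.3.

Rendering as in the statements file (`Real.sqrt` for `^{1/2}`, `rad` computed in `ℕ` as
`UniqueFactorizationMonoid.radical k.natAbs` and cast to `ℝ` afterwards, `log max{|x|,|y|}` as
`Real.log ((max |x| |y| : ℤ) : ℝ)`). Nothing here is an `abc` claim and nothing here endorses the
preprint: typed ≠ proved ≠ endorsed; what is proved is only "claim Thm 1.3 ⟹ Thms 1.1, 1.2, 1.4".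
-/

noncomputable section

open UniqueFactorizationMonoid

namespace Literature.NumberTheory.DiophantineGeometry

namespace Pasten2026

/-! ### Thm 1.1 and Thm 1.4, PROVED from the claim Thm 1.3 ("Since `n̲ ≤ |n|` …", "Since `(n̲)^{1/2} ≤ rad(n)` …") -/

/-- `e < 3`, i.e. `1 < log 3`. [folklore] -/
private theorem one_lt_log_three : (1 : ℝ) < Real.log 3 := by
  rw [Real.lt_log_iff_exp_lt (by norm_num : (0 : ℝ) < 3)]
  exact Real.exp_one_lt_d9.trans (by norm_num)

/-- `log 3 ≤ 2 log 2` (`3 ≤ 4`). [folklore] -/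
private theorem log_three_le_two_mul_log_two : Real.log 3 ≤ 2 * Real.log 2 := by
  have h4 : Real.log 4 = 2 * Real.log 2 := by
    rw [show (4 : ℝ) = 2 ^ 2 by norm_num, Real.log_pow]; push_cast; ring
  rw [← h4]
  exact Real.log_le_log (by norm_num) (by norm_num)

/-- The printed right-hand side of Thm 1.3 at `t = k̲ ≤ K = |k|` is at most twice that of Thm 1.1
(elementary real-analysis bookkeeping; ours). [folklore] -/
private theorem le_two_mul_sqrt_of_truncBound {C t K L : ℝ} (ht1 : 1 ≤ t) (htK : t ≤ K)
    (hL : L ≤ C * Real.sqrt t * Real.log (2 * t) ^ 2 * Real.log (2 * K) *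
      Real.log (t * Real.log (3 * K))) :
    L ≤ 2 * max C 0 * Real.sqrt K * Real.log (2 * K) ^ 4 := by
  have hK1 : 1 ≤ K := ht1.trans htK
  have hL2 : 0 < Real.log (2 * K) := Real.log_pos (by linarith)
  have h2t : 0 ≤ Real.log (2 * t) := Real.log_nonneg (by linarith)
  have h2tK : Real.log (2 * t) ≤ Real.log (2 * K) := Real.log_le_log (by linarith) (by linarith)
  have hM1 : 1 ≤ Real.log (3 * K) :=
    one_lt_log_three.le.trans (Real.log_le_log (by norm_num) (by linarith))
  have hprod1 : 1 ≤ t * Real.log (3 * K) := by nlinarith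
  have h4nn : 0 ≤ Real.log (t * Real.log (3 * K)) := Real.log_nonneg hprod1
  have h4 : Real.log (t * Real.log (3 * K)) ≤ 2 * Real.log (2 * K) := by
    have hle : t * Real.log (3 * K) ≤ 3 * K ^ 2 := by
      have : Real.log (3 * K) ≤ 3 * K := Real.log_le_self (by linarith)
      nlinarith
    calc Real.log (t * Real.log (3 * K)) ≤ Real.log (3 * K ^ 2) :=
          Real.log_le_log (by linarith) hle
      _ = Real.log 3 + 2 * Real.log K := by
          rw [Real.log_mul (by norm_num) (by positivity), Real.log_pow]; push_cast; ring
      _ ≤ 2 * Real.log 2 + 2 * Real.log K := by linarith [log_three_le_two_mul_log_two]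
      _ = 2 * Real.log (2 * K) := by rw [Real.log_mul (by norm_num) (by positivity)]; ring
  have hA : Real.sqrt t * Real.log (2 * t) ^ 2 ≤ Real.sqrt K * Real.log (2 * K) ^ 2 :=
    mul_le_mul (Real.sqrt_le_sqrt htK) (pow_le_pow_left₀ h2t h2tK 2) (sq_nonneg _)
      (Real.sqrt_nonneg _)
  have hB : Real.sqrt t * Real.log (2 * t) ^ 2 * Real.log (2 * K) ≤
      Real.sqrt K * Real.log (2 * K) ^ 2 * Real.log (2 * K) :=
    mul_le_mul_of_nonneg_right hA hL2.le
  have hR : Real.sqrt t * Real.log (2 * t) ^ 2 * Real.log (2 * K) * Real.log (t * Real.log (3 * K)) ≤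
      Real.sqrt K * Real.log (2 * K) ^ 2 * Real.log (2 * K) * (2 * Real.log (2 * K)) :=
    mul_le_mul hB h4 h4nn (mul_nonneg (mul_nonneg (Real.sqrt_nonneg _) (sq_nonneg _)) hL2.le)
  have hRnn : 0 ≤ Real.sqrt t * Real.log (2 * t) ^ 2 * Real.log (2 * K) *
      Real.log (t * Real.log (3 * K)) :=
    mul_nonneg (mul_nonneg (mul_nonneg (Real.sqrt_nonneg _) (sq_nonneg _)) hL2.le) h4nn
  calc L ≤ C * Real.sqrt t * Real.log (2 * t) ^ 2 * Real.log (2 * K) *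
        Real.log (t * Real.log (3 * K)) := hL
    _ = C * (Real.sqrt t * Real.log (2 * t) ^ 2 * Real.log (2 * K) *
        Real.log (t * Real.log (3 * K))) := by ring
    _ ≤ max C 0 * (Real.sqrt t * Real.log (2 * t) ^ 2 * Real.log (2 * K) *
        Real.log (t * Real.log (3 * K))) := mul_le_mul_of_nonneg_right (le_max_left _ _) hRnn
    _ ≤ max C 0 * (Real.sqrt K * Real.log (2 * K) ^ 2 * Real.log (2 * K) * (2 * Real.log (2 * K))) :=
        mul_le_mul_of_nonneg_left hR (le_max_right _ _)
    _ = 2 * max C 0 * Real.sqrt K * Real.log (2 * K) ^ 4 := by ring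

/-- The printed right-hand side of Thm 1.3 at `t = k̲ ≤ r² = rad(k)²` is at most `8` times that of
Thm 1.4 (elementary real-analysis bookkeeping; ours). [folklore] -/
private theorem le_eight_mul_radical_of_truncBound {C t r K L : ℝ} (ht1 : 1 ≤ t) (htr : t ≤ r ^ 2)
    (hr1 : 1 ≤ r) (hK1 : 1 ≤ K)
    (hL : L ≤ C * Real.sqrt t * Real.log (2 * t) ^ 2 * Real.log (2 * K) *
      Real.log (t * Real.log (3 * K))) :
    L ≤ 8 * max C 0 * r * Real.log (2 * r) ^ 2 * Real.log (2 * K) *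
      Real.log (r * Real.log (3 * K)) := by
  have hL2 : 0 < Real.log (2 * K) := Real.log_pos (by linarith)
  have h2t : 0 ≤ Real.log (2 * t) := Real.log_nonneg (by linarith)
  have hM1 : 1 ≤ Real.log (3 * K) :=
    one_lt_log_three.le.trans (Real.log_le_log (by norm_num) (by linarith))
  have hprod1 : 1 ≤ t * Real.log (3 * K) := by nlinarith
  have h4nn : 0 ≤ Real.log (t * Real.log (3 * K)) := Real.log_nonneg hprod1
  -- `√t ≤ r`
  have hsq : Real.sqrt t ≤ r := by
    calc Real.sqrt t ≤ Real.sqrt (r ^ 2) := Real.sqrt_le_sqrt htr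
      _ = r := Real.sqrt_sq (by linarith)
  -- `log(2t) ≤ log(2r²) ≤ log((2r)²) = 2 log(2r)`
  have h2 : Real.log (2 * t) ≤ 2 * Real.log (2 * r) := by
    calc Real.log (2 * t) ≤ Real.log ((2 * r) ^ 2) :=
          Real.log_le_log (by linarith) (by nlinarith)
      _ = 2 * Real.log (2 * r) := by rw [Real.log_pow]; push_cast; ring
  have h2sq : Real.log (2 * t) ^ 2 ≤ 4 * Real.log (2 * r) ^ 2 := by
    calc Real.log (2 * t) ^ 2 ≤ (2 * Real.log (2 * r)) ^ 2 := pow_le_pow_left₀ h2t h2 2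
      _ = 4 * Real.log (2 * r) ^ 2 := by ring
  -- `log(t log 3K) ≤ log(r² (log 3K)²) = 2 log(r log 3K)`
  have h4 : Real.log (t * Real.log (3 * K)) ≤ 2 * Real.log (r * Real.log (3 * K)) := by
    have hle : t * Real.log (3 * K) ≤ (r * Real.log (3 * K)) ^ 2 := by
      have hM0 : 0 ≤ Real.log (3 * K) := by linarith
      have h1 : t * Real.log (3 * K) ≤ r ^ 2 * Real.log (3 * K) :=
        mul_le_mul_of_nonneg_right htr hM0
      have hMM : Real.log (3 * K) ≤ Real.log (3 * K) ^ 2 := by nlinarith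
      calc t * Real.log (3 * K) ≤ r ^ 2 * Real.log (3 * K) := h1
        _ ≤ r ^ 2 * Real.log (3 * K) ^ 2 := mul_le_mul_of_nonneg_left hMM (sq_nonneg r)
        _ = (r * Real.log (3 * K)) ^ 2 := by ring
    calc Real.log (t * Real.log (3 * K)) ≤ Real.log ((r * Real.log (3 * K)) ^ 2) :=
          Real.log_le_log (by linarith) hle
      _ = 2 * Real.log (r * Real.log (3 * K)) := by rw [Real.log_pow]; push_cast; ring
  have hA : Real.sqrt t * Real.log (2 * t) ^ 2 ≤ r * (4 * Real.log (2 * r) ^ 2) :=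
    mul_le_mul hsq h2sq (sq_nonneg _) (by linarith)
  have hB : Real.sqrt t * Real.log (2 * t) ^ 2 * Real.log (2 * K) ≤
      r * (4 * Real.log (2 * r) ^ 2) * Real.log (2 * K) :=
    mul_le_mul_of_nonneg_right hA hL2.le
  have hR : Real.sqrt t * Real.log (2 * t) ^ 2 * Real.log (2 * K) * Real.log (t * Real.log (3 * K)) ≤
      r * (4 * Real.log (2 * r) ^ 2) * Real.log (2 * K) * (2 * Real.log (r * Real.log (3 * K))) :=
    mul_le_mul hB h4 h4nn
      (mul_nonneg (mul_nonneg (by linarith) (mul_nonneg (by norm_num) (sq_nonneg _))) hL2.le)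
  have hRnn : 0 ≤ Real.sqrt t * Real.log (2 * t) ^ 2 * Real.log (2 * K) *
      Real.log (t * Real.log (3 * K)) :=
    mul_nonneg (mul_nonneg (mul_nonneg (Real.sqrt_nonneg _) (sq_nonneg _)) hL2.le) h4nn
  calc L ≤ C * Real.sqrt t * Real.log (2 * t) ^ 2 * Real.log (2 * K) *
        Real.log (t * Real.log (3 * K)) := hL
    _ = C * (Real.sqrt t * Real.log (2 * t) ^ 2 * Real.log (2 * K) *
        Real.log (t * Real.log (3 * K))) := by ring
    _ ≤ max C 0 * (Real.sqrt t * Real.log (2 * t) ^ 2 * Real.log (2 * K) *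
        Real.log (t * Real.log (3 * K))) := mul_le_mul_of_nonneg_right (le_max_left _ _) hRnn
    _ ≤ max C 0 * (r * (4 * Real.log (2 * r) ^ 2) * Real.log (2 * K) *
        (2 * Real.log (r * Real.log (3 * K)))) := mul_le_mul_of_nonneg_left hR (le_max_right _ _)
    _ = 8 * max C 0 * r * Real.log (2 * r) ^ 2 * Real.log (2 * K) *
        Real.log (r * Real.log (3 * K)) := by ring

/-- **Pasten 2026 (arXiv v1), Theorem 1.1** (Bound for Mordell's equation), PROVED here from the claim
Thm 1.3 exactly as printed ("Since `n̲ ≤ |n|` we see that Theorem 1.1 is a consequence of [Thm 1.3]"):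
*"Let `k` be a non-zero integer. The solutions of `y² = x³ + k` in `ℤ` satisfy
`log max{|x|,|y|} ≪ |k|^{1/2} (log(2|k|))⁴` where the implicit constant is effective and absolute."*
Printed context: Baker 1968 `≪ |k|^{10000}`, Stark 1973 `≪_ε |k|^{1+ε}`, "the first power saving
since Stark's bound more than five decades ago, replacing `|k|^{1+ε}` by `|k|^{1/2+ε}`". Conditional
on the CLAIM `mordell_log_le_truncTwo` (our constant: `2 max(C,0)`).
[claim: Pasten2026ThueMahlerMordell, status: under-review] -/
theorem mordell_log_le_sqrt (h : mordell_log_le_truncTwo) :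
    ∃ C : ℝ, ∀ k : ℤ, k ≠ 0 → ∀ x y : ℤ, y ^ 2 = x ^ 3 + k →
      Real.log ((max |x| |y| : ℤ) : ℝ) ≤ C * Real.sqrt |(k : ℝ)| * Real.log (2 * |(k : ℝ)|) ^ 4 := by
  obtain ⟨C, hC⟩ := h
  refine ⟨2 * max C 0, fun k hk x y hxy => ?_⟩
  have ht1 : (1 : ℝ) ≤ (truncTwo k : ℝ) := by exact_mod_cast truncTwo_pos k
  have htK : (truncTwo k : ℝ) ≤ |(k : ℝ)| := by
    have h1 : ((truncTwo k : ℕ) : ℝ) ≤ ((k.natAbs : ℕ) : ℝ) := by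
      exact_mod_cast truncTwo_le_natAbs hk
    rwa [Nat.cast_natAbs, Int.cast_abs] at h1
  exact le_two_mul_sqrt_of_truncBound ht1 htK (hC k hk x y hxy)

/-- **Pasten 2026 (arXiv v1), Theorem 1.4** (Bound for Mordell's equation, with radical), PROVED here
from the claim Thm 1.3 exactly as printed ("Since `(n̲)^{1/2} ≤ rad(n)` we deduce"): *"Let `k` be a
non-zero integer. The solutions of `y² = x³ + k` in `ℤ` satisfy
`log max{|x|,|y|} ≪ rad(k) (log(2 rad(k)))² log(2|k|) log(rad(k) log(3|k|))` where the implicit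
constant is effective and absolute."* (`rad(k) = ∏_{p ∣ k} p`, computed in `ℕ` as
`UniqueFactorizationMonoid.radical k.natAbs`.) Conditional on the CLAIM `mordell_log_le_truncTwo`
(our constant: `8 max(C,0)`). [claim: Pasten2026ThueMahlerMordell, status: under-review] -/
theorem mordell_log_le_radical (h : mordell_log_le_truncTwo) :
    ∃ C : ℝ, ∀ k : ℤ, k ≠ 0 → ∀ x y : ℤ, y ^ 2 = x ^ 3 + k →
      Real.log ((max |x| |y| : ℤ) : ℝ) ≤
        C * ((radical k.natAbs : ℕ) : ℝ) * Real.log (2 * ((radical k.natAbs : ℕ) : ℝ)) ^ 2 *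
          Real.log (2 * |(k : ℝ)|) * Real.log (((radical k.natAbs : ℕ) : ℝ) * Real.log (3 * |(k : ℝ)|)) := by
  obtain ⟨C, hC⟩ := h
  refine ⟨8 * max C 0, fun k hk x y hxy => ?_⟩
  have ht1 : (1 : ℝ) ≤ (truncTwo k : ℝ) := by exact_mod_cast truncTwo_pos k
  have htr : (truncTwo k : ℝ) ≤ ((radical k.natAbs : ℕ) : ℝ) ^ 2 := by
    exact_mod_cast truncTwo_le_radical_sq k
  have hr1 : (1 : ℝ) ≤ ((radical k.natAbs : ℕ) : ℝ) := by
    exact_mod_cast Nat.one_le_iff_ne_zero.mpr (radical_ne_zero (a := k.natAbs))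
  have hK1 : (1 : ℝ) ≤ |(k : ℝ)| := by exact_mod_cast Int.one_le_abs hk
  exact le_eight_mul_radical_of_truncBound ht1 htr hr1 hK1 (hC k hk x y hxy)

/-! ### Thm 1.2 (gap between squares and cubes), PROVED from the Thm 1.1 bound -/

/-- **Pasten 2026 (arXiv v1), Theorem 1.2** (Gap between squares and cubes), PROVED here from the
Thm 1.1 bound taken as a hypothesis formula ("An immediate consequence of Theorem 1.1 is:"): *"For all
integers `x, y` with `x³ ≠ y²` we have `|x³ − y²| ≫ (log X)² / (log log X)⁸`, `X = max{3, |x|, |y|}`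
where the implicit constant is effective and absolute."* (`≫`: one absolute `c > 0` with
`c · (log X)²/(log log X)⁸ ≤ |x³ − y²|`; `log log X ≥ log log 3 > 0`.) The inversion: with
`k = y² − x³`, `T = log X ≤ C' |k|^{1/2} (log 2|k|)⁴`; if `|k| ≥ T²` there is nothing to do, else
`log(2|k|) ≤ A log T` and `|k| ≥ T²/(C'² A⁸ (log T)⁸)`. Printed context (p. 2): "Before our work, all
available unconditional lower bounds for `|x³ − y²|` in terms of `X` had the form `(log X)^{1−o(1)}`
… an (admittedly modest) step forward in the direction of Hall's conjecture" (the tree's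
`HallConjecture`, abc.S17, strength `X^{1/2−ε}`, not comparable in kind).
[claim: Pasten2026ThueMahlerMordell, status: under-review] -/
theorem cube_sub_sq_ge_of_mordell_log_le_sqrt
    (h11 : ∃ C : ℝ, ∀ k : ℤ, k ≠ 0 → ∀ x y : ℤ, y ^ 2 = x ^ 3 + k →
      Real.log ((max |x| |y| : ℤ) : ℝ) ≤ C * Real.sqrt |(k : ℝ)| * Real.log (2 * |(k : ℝ)|) ^ 4) :
    ∃ c : ℝ, 0 < c ∧ ∀ x y : ℤ, x ^ 3 ≠ y ^ 2 →
      c * Real.log (max 3 (max |(x : ℝ)| |(y : ℝ)|)) ^ 2 /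
          Real.log (Real.log (max 3 (max |(x : ℝ)| |(y : ℝ)|))) ^ 8 ≤
        |(x : ℝ) ^ 3 - (y : ℝ) ^ 2| := by
  obtain ⟨C, hC⟩ := h11
  have hlog2 : 0 < Real.log 2 := Real.log_pos (by norm_num)
  have hlog3 : 1 < Real.log 3 := one_lt_log_three
  -- the constants
  set ℓ₀ : ℝ := Real.log (Real.log 3) with hℓ₀
  have hℓ₀pos : 0 < ℓ₀ := Real.log_pos hlog3
  have hq : 0 < Real.log 3 / Real.log 2 ^ 4 := div_pos (by linarith) (pow_pos hlog2 4)
  set C' : ℝ := max C 0 + Real.log 3 / Real.log 2 ^ 4 with hC'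
  have hC'C : max C 0 ≤ C' := by rw [hC']; linarith
  have hC'q : Real.log 3 / Real.log 2 ^ 4 ≤ C' := by rw [hC']; linarith [le_max_right C 0]
  have hC'pos : 0 < C' := hq.trans_le hC'q
  set A : ℝ := 2 + Real.log 2 / ℓ₀ with hA
  have hApos : 0 < A := by have := div_pos hlog2 hℓ₀pos; rw [hA]; linarith
  refine ⟨min (ℓ₀ ^ 8) (1 / (C' ^ 2 * A ^ 8)), lt_min (pow_pos hℓ₀pos 8) (by positivity),
    fun x y hne => ?_⟩
  -- the parameter `k = y² − x³ ≠ 0`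
  set k : ℤ := y ^ 2 - x ^ 3 with hk
  have hk0 : k ≠ 0 := by
    intro h0
    rw [hk] at h0
    exact hne (sub_eq_zero.mp h0).symm
  have hxy : y ^ 2 = x ^ 3 + k := by rw [hk]; ring
  have hL := hC k hk0 x y hxy
  have hu : |(k : ℝ)| = |(x : ℝ) ^ 3 - (y : ℝ) ^ 2| := by
    rw [hk]; push_cast; exact abs_sub_comm _ _
  rw [hu] at hL
  have hu1 : (1 : ℝ) ≤ |(x : ℝ) ^ 3 - (y : ℝ) ^ 2| := by
    have h1 : (1 : ℝ) ≤ |(k : ℝ)| := by exact_mod_cast Int.one_le_abs hk0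
    rwa [hu] at h1
  set u : ℝ := |(x : ℝ) ^ 3 - (y : ℝ) ^ 2| with hu_def
  -- `X` and `T = log X`
  have hM : ((max |x| |y| : ℤ) : ℝ) = max |(x : ℝ)| |(y : ℝ)| := by norm_cast
  set X : ℝ := max 3 (max |(x : ℝ)| |(y : ℝ)|) with hX
  have hX3 : (3 : ℝ) ≤ X := le_max_left _ _
  set T : ℝ := Real.log X with hT
  have hT3 : Real.log 3 ≤ T := Real.log_le_log (by norm_num) hX3
  have hT1 : 1 < T := hlog3.trans_le hT3
  have hlogT : ℓ₀ ≤ Real.log T := Real.log_le_log (by linarith) hT3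
  have hlogTpos : 0 < Real.log T := hℓ₀pos.trans_le hlogT
  -- Step 1: `T ≤ C' · √u · (log 2u)⁴`
  set F : ℝ := Real.sqrt u * Real.log (2 * u) ^ 4 with hF
  have hlog2u : Real.log 2 ≤ Real.log (2 * u) := Real.log_le_log (by norm_num) (by linarith)
  have hFge : Real.log 2 ^ 4 ≤ F := by
    have h1 : (1 : ℝ) ≤ Real.sqrt u := by
      rw [show (1 : ℝ) = Real.sqrt 1 by simp]; exact Real.sqrt_le_sqrt hu1
    have h2 : Real.log 2 ^ 4 ≤ Real.log (2 * u) ^ 4 := pow_le_pow_left₀ hlog2.le hlog2u 4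
    calc Real.log 2 ^ 4 = 1 * Real.log 2 ^ 4 := (one_mul _).symm
      _ ≤ Real.sqrt u * Real.log (2 * u) ^ 4 :=
          mul_le_mul h1 h2 (pow_nonneg hlog2.le 4) (Real.sqrt_nonneg _)
  have hFnn : 0 ≤ F := (pow_nonneg hlog2.le 4).trans hFge
  have hTF : T ≤ C' * F := by
    by_cases h3 : (3 : ℝ) ≤ max |(x : ℝ)| |(y : ℝ)|
    · have hXeq : X = max |(x : ℝ)| |(y : ℝ)| := max_eq_right h3
      have h1 : T ≤ C * F := by
        rw [hT, hXeq, ← hM, hF, ← mul_assoc]; exact hL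
      calc T ≤ C * F := h1
        _ ≤ max C 0 * F := mul_le_mul_of_nonneg_right (le_max_left _ _) hFnn
        _ ≤ C' * F := mul_le_mul_of_nonneg_right hC'C hFnn
    · have hXeq : X = 3 := max_eq_left (le_of_lt (not_le.mp h3))
      have hne4 : Real.log 2 ^ 4 ≠ 0 := (pow_pos hlog2 4).ne'
      calc T = Real.log 3 := by rw [hT, hXeq]
        _ = Real.log 3 / Real.log 2 ^ 4 * Real.log 2 ^ 4 := (div_mul_cancel₀ _ hne4).symm
        _ ≤ Real.log 3 / Real.log 2 ^ 4 * F := mul_le_mul_of_nonneg_left hFge hq.le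
        _ ≤ C' * F := mul_le_mul_of_nonneg_right hC'q hFnn
  -- Step 2: inversion
  show min (ℓ₀ ^ 8) (1 / (C' ^ 2 * A ^ 8)) * T ^ 2 / Real.log T ^ 8 ≤ u
  have hlT8 : 0 < Real.log T ^ 8 := pow_pos hlogTpos 8
  rw [div_le_iff₀ hlT8]
  by_cases hcase : T ^ 2 ≤ u
  · have h8 : ℓ₀ ^ 8 ≤ Real.log T ^ 8 := pow_le_pow_left₀ hℓ₀pos.le hlogT 8
    calc min (ℓ₀ ^ 8) (1 / (C' ^ 2 * A ^ 8)) * T ^ 2 ≤ Real.log T ^ 8 * T ^ 2 :=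
        mul_le_mul_of_nonneg_right ((min_le_left _ _).trans h8) (sq_nonneg _)
      _ ≤ Real.log T ^ 8 * u := mul_le_mul_of_nonneg_left hcase hlT8.le
      _ = u * Real.log T ^ 8 := mul_comm _ _
  · have hu_lt : u < T ^ 2 := not_le.mp hcase
    -- `log(2u) ≤ A log T`
    have h2u : Real.log (2 * u) ≤ A * Real.log T := by
      have h1 : Real.log (2 * u) ≤ Real.log 2 + 2 * Real.log T := by
        have h0 : Real.log (2 * u) ≤ Real.log (2 * T ^ 2) :=
          Real.log_le_log (by linarith) (by linarith)
        have h0' : Real.log (2 * T ^ 2) = Real.log 2 + 2 * Real.log T := by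
          rw [Real.log_mul (by norm_num) (by positivity), Real.log_pow]; push_cast; ring
        linarith
      have h2 : Real.log 2 ≤ Real.log 2 / ℓ₀ * Real.log T := by
        rw [div_mul_eq_mul_div, le_div_iff₀ hℓ₀pos]
        exact mul_le_mul_of_nonneg_left hlogT hlog2.le
      calc Real.log (2 * u) ≤ Real.log 2 + 2 * Real.log T := h1
        _ ≤ Real.log 2 / ℓ₀ * Real.log T + 2 * Real.log T := by linarith
        _ = A * Real.log T := by rw [hA]; ring
    have h2u4 : Real.log (2 * u) ^ 4 ≤ A ^ 4 * Real.log T ^ 4 := by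
      rw [← mul_pow]; exact pow_le_pow_left₀ (hlog2.le.trans hlog2u) h2u 4
    set G : ℝ := C' * A ^ 4 * Real.log T ^ 4 with hG
    have hGpos : 0 < G := by positivity
    have hTG : T ≤ G * Real.sqrt u := by
      calc T ≤ C' * F := hTF
        _ = C' * Real.sqrt u * Real.log (2 * u) ^ 4 := by rw [hF]; ring
        _ ≤ C' * Real.sqrt u * (A ^ 4 * Real.log T ^ 4) :=
            mul_le_mul_of_nonneg_left h2u4 (mul_nonneg hC'pos.le (Real.sqrt_nonneg _))
        _ = G * Real.sqrt u := by rw [hG]; ring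
    have hsq : (T / G) ^ 2 ≤ u := by
      have h1 : T / G ≤ Real.sqrt u := by rw [div_le_iff₀ hGpos, mul_comm]; exact hTG
      have h0 : 0 ≤ T / G := div_nonneg (by linarith) hGpos.le
      calc (T / G) ^ 2 ≤ Real.sqrt u ^ 2 := pow_le_pow_left₀ h0 h1 2
        _ = u := Real.sq_sqrt (by linarith)
    have hC'ne : C' ≠ 0 := hC'pos.ne'
    have hAne : A ≠ 0 := hApos.ne'
    have hlTne : Real.log T ≠ 0 := hlogTpos.ne'
    have hTG2 : (T / G) ^ 2 * Real.log T ^ 8 = 1 / (C' ^ 2 * A ^ 8) * T ^ 2 := by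
      rw [hG]; field_simp
    calc min (ℓ₀ ^ 8) (1 / (C' ^ 2 * A ^ 8)) * T ^ 2 ≤ 1 / (C' ^ 2 * A ^ 8) * T ^ 2 :=
        mul_le_mul_of_nonneg_right (min_le_right _ _) (sq_nonneg _)
      _ = (T / G) ^ 2 * Real.log T ^ 8 := hTG2.symm
      _ ≤ u * Real.log T ^ 8 := mul_le_mul_of_nonneg_right hsq hlT8.le

/-- **Pasten 2026 (arXiv v1), Theorem 1.2** from the claim Thm 1.3 (via Thm 1.1): for one absolute
`c > 0`, `c · (log X)²/(log log X)⁸ ≤ |x³ − y²|` for all integers `x, y` with `x³ ≠ y²`,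
`X = max{3, |x|, |y|}`. Conditional on the CLAIM `mordell_log_le_truncTwo`.
[claim: Pasten2026ThueMahlerMordell, status: under-review] -/
theorem cube_sub_sq_ge (h : mordell_log_le_truncTwo) :
    ∃ c : ℝ, 0 < c ∧ ∀ x y : ℤ, x ^ 3 ≠ y ^ 2 →
      c * Real.log (max 3 (max |(x : ℝ)| |(y : ℝ)|)) ^ 2 /
          Real.log (Real.log (max 3 (max |(x : ℝ)| |(y : ℝ)|))) ^ 8 ≤
        |(x : ℝ) ^ 3 - (y : ℝ) ^ 2| :=
  cube_sub_sq_ge_of_mordell_log_le_sqrt (mordell_log_le_sqrt h)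

end Pasten2026

end Literature.NumberTheory.DiophantineGeometry

end
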